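import Summits.BirchSwinnertonDyer.Rank1Residual.P2.CongruentNumberPairsAtTwoEvenPairTable
import Summits.BirchSwinnertonDyer.Rank1Residual.P2.Conjectures.CongruentNumberEvenMonskyLawAtTwo
import Summits.BirchSwinnertonDyer.Rank1Residual.P2.Conjectures.CongruentNumberSilentEvenFiveAtTwo
import HarnessLib

/-!
# Sub-lane «bsd-p2»: the `k = 2` RUNG of the TYPED even Monsky law at `2` IS C-P2-1 — both directions,
# as KERNEL bookkeeping theorems between the LANDED schemas (p2-typer GEN 21 terms, RE-KEYED by
# GEN 25 against the landed law `P2/Conjectures/CongruentNumberEvenMonskyLawAtTwo.lean` (p363094) and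
# rung file `…RungTwo.lean` (p365071); file 2 of 2 of the (ε′) ORDER 1′ pair — proposed only on
# p2-lead's SWEEP 2026-08-24 (ε′) ORDER 1′ word, after file 1)

HONEST FRAMING (sub-lane «bsd-p2», run/shared/lean/b2b/bsd-rank1-residual/p2/, verbatim in every
file): the target of record is the FULL Birch–Swinnerton-Dyer formula for EVERY analytic-rank `≤ 1`
`E/ℚ` at ALL primes INCLUDING `2`; the odd-prime class ledger is referee A's; the `2`-part is OPEN
(cells O1 = X5 ∖ CM and O12 = the CM corner) and under census by «bsd-p2». Census / instrument
output at `2` = EVIDENCE / conjecture items with held-out validation, NEVER a Literature fact;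
certificates close PAIRS (one isogeny class, `p = 2`), never classes. A conjecture `Prop` is a
SENTENCE. This file asserts NO arithmetic fact and NO conjecture: it neither assumes nor proves
C-P2-1 (`P2.Conjectures.CongruentSilentEvenFiveBSDTwo`, p344657) nor any rung
`P2.Conjectures.CongruentEvenBSDTwoAt k` / `CongruentSilentEvenBSDTwoAt k` of the typed law C-P2-2
(p363094); every statement is an implication or an equivalence BETWEEN these `Prop`s, modulo
DISPLAYED named facts (`hU` = U⁺ verbatim as in `P2.rankOneDatum_of_uPlus_six`, a hypothesis, not a
fact of the tree; `hGZK`; `hMe`; `hR` = Rédei–Reichardt) — and with NO fact at all for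
«rung two ⟹ C-P2-1».

WHAT IT DOES (with the `k = 2` cell table of file 1, `P2/CongruentNumberPairsAtTwoEvenPairTable.lean`,
and the landed law file's §4 RULE — DOOR B6 over census vocabulary
`Conjectures.rankOne_sha_bsdp_two_congruentNumberCurve_two_mul_prod_of_odd_genusSum₂'` and
`Conjectures.congruentEvenBSDTwoAt_of_silent`, which this re-keyed file USES instead of re-proving):
* §5 CORE (ordered pair, modulo `hR` alone): C-P2-1 ⟹ `r_an = 1 ∧ BSD₂` on every silent `s = 1` cell
  `n = 2pq` — case `p ≡ 5 (8)`, `(p/q) = −1`: C-P2-1 itself; the three other sign/residue cases are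
  loud (`Σ₂′` odd, file 1 §3) or have `s = 3` (file 1 §2), hence vacuous;
* §6 THE RUNG STATEMENTS ON THE LANDED SCHEMAS: `CongruentSilentEvenBSDTwoAt 2 ⟺ C-P2-1` modulo `hR`
  ALONE; `CongruentEvenBSDTwoAt 2 ⟹ C-P2-1` with NO FACT (`s(2p₅q) = 1` is file 1's linear algebra —
  the fact-free sibling of the landed `Conjectures.congruentSilentEvenFiveBSDTwo_of_congruentEvenBSDTwoAt_two`
  (p365071), which takes `hMe` + Monsky Cor. 5.15 (2′) `h515` for the same step); `C-P2-1 ⟹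
  CongruentEvenBSDTwoAt 2` modulo {`hU`, GZK, `hMe`, `hR`} through the law file's rule; hence
  `CongruentEvenBSDTwoAt 2 ⟺ C-P2-1`. (The tagged-law form `CongruentEvenMonskyBSDTwo ⟹ C-P2-1` is
  p365071's theorem (modulo `hMe` + `h515`) and is deliberately NOT restated here fact-free: a theorem
  whose only hypothesis is a tagged conjecture audits as «proof-of-item» for C-P2-1 — a misreadable
  shape; see the GEN25 memo.)
VALUE: under the ruled quantifier (U) `2 ≤ k` the typed law adds NOTHING at `k = 2` beyond C-P2-1 —
kernel-exactly, both directions, modulo only facts the landed doors already display («one token, not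
two» as a kernel object on BOTH sides; p365071 gave ⟹ modulo `hMe` + `h515`). A rung equivalence
books nothing and moves no mark; per-pair statements live in the OPEN cell `openO12`. 0 facts,
0 defs, 0 (K). Unit `b2b-bsdres-p2-typer` GEN 21 (terms @5cec224e66cd3d47) / GEN 25 (re-key @d41efcf66f0f1736,
p2-lead GEN 9 T-173) / GEN 26 (docstring refresh T-176, decl terms byte-identical); bytes pre-read by p2-ref
GEN 48 — R3 PRE-READ PASS `p2/REFEREE.md` l.447 (2026-08-23); proposed on p2-lead's SWEEP 2026-08-24 (ε′)
ORDER 1′ word (LEAD-OKS § GEN 10 BATCH 86), after FILE 1 lands, ≤ 1 in flight. Registration record of the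
rungs this file meets: `p2/STRUCTURE-p2.md` v0.20 @504108a805ad3079 (§6 C-P2-1 typed p344657; §7 C-P2-2 typed
p363094 + RungTwo p365071; §3 PR-P2-5/6/7 HIT).

References: [Monsky1990MockHeegner] Cor. 5.15 (2′), p. 67 Rem. (3); [TianYuanZhang2017] Thm 1.2,
Thm 3.5, §1 (1.1); [HeathBrown1994SelmerCongruentII] Appendix (Monsky) p. 41 L20–L36; [Miller2011LMS]
Def 1.1; HOME/p2/typer/lean/conjectures/GEN21-EVEN-RUNG-TWO.md §B/§H, GEN25-ORDER1-READINESS.md.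
-/

noncomputable section

open scoped Classical
open Matrix Finset WeierstrassCurve NumberField Literature.NumberTheory.EllipticCurves
  Literature.NumberTheory.EllipticCurves.Rank1Residual
  Literature.NumberTheory.EllipticCurves.Rank1Residual.Typed
  Literature.NumberTheory.EllipticCurves.Monsky1990
  Literature.NumberTheory.EllipticCurves.HeathBrown1994
  Literature.NumberTheory.EllipticCurves.HeathBrown1994.Families
  Literature.NumberTheory.EllipticCurves.TianYuanZhang2017
  Literature.NumberTheory.EllipticCurves.Tian2014
  Literature.NumberTheory.QuadraticFields.RedeiReichardt

set_option autoImplicit false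

namespace Summit.BirchSwinnertonDyer.Rank1Residual.P2

/-! ## §5 The core of the `k = 2` rung: C-P2-1 on an ordered silent pair (modulo `hR` alone) -/

section Rung

/-- **THE SILENT RUNG AT `k = 2`, CORE (ordered pair).** Modulo Rédei–Reichardt ALONE, C-P2-1 gives the
even law on every SILENT `s = 1` cell with two odd prime factors: for `p ≡ 1 (mod 4)`, `q ≡ 3 (mod 4)`
distinct primes with `s(2pq) = 1` (either tuple order) and `Σ₂′(2pq)` even — case `p ≡ 5 (8)`,
`(p/q) = −1`: C-P2-1 itself; `(p/q) = +1`: `Σ₂′` is odd (file 1 §3), absurd; `p ≡ 1 (8)`, `(p/q) = −1`: `Σ₂′` odd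
(class `6`), absurd; `(p/q) = +1`: `s = 3` (file 1 §2), absurd. Asserts nothing: C-P2-1 is the hypothesis `h`.
[cite: Monsky1990MockHeegner, Cor. 5.15 (2′) and p. 67 Rem. (3)] [cite: TianYuanZhang2017, Thm. 1.2] -/
theorem rankOne_bsdp_two_pair_of_congruentSilentEvenFiveBSDTwo
    (hR : redeiReichardt_fourTwoCard_classGroup) (h : Conjectures.CongruentSilentEvenFiveBSDTwo)
    {p q : ℕ} (hp : p.Prime) (hq : q.Prime) (hp4 : p % 4 = 1) (hq4 : q % 4 = 3)
    (hs : monskySelmerRankEven ![p, q] = 1 ∨ monskySelmerRankEven ![q, p] = 1)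
    (hev : Even (genusSum₂' (2 * (p * q)) fun d => genusClassNumber (GenusField d))) :
    (congruentNumberCurve (2 * (p * q))).analyticRank = 1 ∧
      BSDp (congruentNumberCurve (2 * (p * q))) 2 := by
  have hne : p ≠ q := fun e => by omega
  rcases jacobiSym_eq_one_or_eq_neg_one_of_prime_ne hp hq hne with hj | hj <;>
    rcases (show p % 8 = 1 ∨ p % 8 = 5 by omega) with h1 | h5
  · obtain ⟨h3, h3'⟩ := monskySelmerRankEven_one_pair_of_jacobiSym_eq_one hp hq h1 hq4 hj
    exfalso; rcases hs with hs | hs <;> omega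
  · exact absurd (odd_genusSum₂'_genusField_two_mul_five_mul hR hp hq h5 hq4 hj)
      (Nat.not_odd_iff_even.mpr hev)
  · exact absurd (odd_genusSum₂'_genusField_two_mul_one_pair hR hp hq h1 hq4 hj)
      (Nat.not_odd_iff_even.mpr hev)
  · exact h p q hp hq h5 hq4 hj

/-! ## §6 The `k = 2` rung of the typed law IS C-P2-1 — stated on the LANDED schemas
`Conjectures.CongruentSilentEvenBSDTwoAt 2` / `Conjectures.CongruentEvenBSDTwoAt 2` (p363094) -/

/-- **C-P2-1 ⟹ THE SILENT RUNG `CongruentSilentEvenBSDTwoAt 2`**, modulo Rédei–Reichardt ALONE: a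
`Fin 2` cell `2t₀t₁ ≡ 6 (mod 8)` is an ordered pair `{p ≡ 1 (4), q ≡ 3 (4)}` in one of the two tuple
orders (file 1 `exists_pair_of_two_mul_prod_mod_eight_six`); apply §5. Asserts neither `Prop`.
[cite: Monsky1990MockHeegner, p. 67 Rem. (3)] [cite: TianYuanZhang2017, Thm. 1.2] -/
theorem congruentSilentEvenBSDTwoAt_two_of_congruentSilentEvenFiveBSDTwo
    (hR : redeiReichardt_fourTwoCard_classGroup) (h : Conjectures.CongruentSilentEvenFiveBSDTwo) :
    Conjectures.CongruentSilentEvenBSDTwoAt 2 := by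
  intro t ht hinj h6 hs hev
  obtain ⟨p, q, hp, hq, -, hp4, hq4, hpq, htt⟩ := exists_pair_of_two_mul_prod_mod_eight_six t ht hinj h6
  rw [Fin.prod_univ_two, hpq] at hev ⊢
  refine rankOne_bsdp_two_pair_of_congruentSilentEvenFiveBSDTwo hR h hp hq hp4 hq4 ?_ hev
  rcases htt with rfl | rfl
  · exact Or.inl hs
  · exact Or.inr hs

/-- **THE SILENT RUNG `CongruentSilentEvenBSDTwoAt 2` ⟹ C-P2-1**, modulo Rédei–Reichardt ALONE (needed
only to certify that `𝒮⁻` is silent, file 1 §3; `s(2p₅q) = 1` is file 1 §2's linear algebra — no Monsky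
fact, no Cor 5.15). [cite: Monsky1990MockHeegner, Cor. 5.15 (2′)] [cite: TianYuanZhang2017, Thm. 1.2] -/
theorem congruentSilentEvenFiveBSDTwo_of_congruentSilentEvenBSDTwoAt_two
    (hR : redeiReichardt_fourTwoCard_classGroup) (h : Conjectures.CongruentSilentEvenBSDTwoAt 2) :
    Conjectures.CongruentSilentEvenFiveBSDTwo := by
  intro p q hp hq hp5 hq4 hj
  have hne : p ≠ q := fun e => by omega
  have ht : ∀ i, (![p, q] i).Prime := fun i => by fin_cases i <;> assumption
  have hinj : Function.Injective ![p, q] := by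
    intro i j hij
    fin_cases i <;> fin_cases j <;> simp_all [hne.symm]
  have hprod : ∏ i, ![p, q] i = p * q := by simp [Fin.prod_univ_two]
  have h6 : (2 * ∏ i, ![p, q] i) % 8 = 6 := by
    rw [hprod]
    have : (p * q) % 4 = 3 := by rw [Nat.mul_mod, show p % 4 = 1 by omega, hq4]
    omega
  have hres := h _ ht hinj h6 (monskySelmerRankEven_five_pair hp hq hp5 hq4)
  rw [hprod] at hres
  exact hres (even_genusSum₂'_genusField_two_mul_five_mul hR hp hq hp5 hq4 hj)

/-- **RUNG TWO, SILENT FORM: `CongruentSilentEvenBSDTwoAt 2 ⟺ C-P2-1`, modulo Rédei–Reichardt ALONE.**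
At `k = 2` the silent `s = 1` cells are exactly `𝒮⁻`; asserts neither side.
[cite: Monsky1990MockHeegner, Cor. 5.15 (2′) and p. 67 Rem. (3)] [cite: TianYuanZhang2017, Thm. 1.2] -/
theorem congruentSilentEvenBSDTwoAt_two_iff (hR : redeiReichardt_fourTwoCard_classGroup) :
    Conjectures.CongruentSilentEvenBSDTwoAt 2 ↔ Conjectures.CongruentSilentEvenFiveBSDTwo :=
  ⟨congruentSilentEvenFiveBSDTwo_of_congruentSilentEvenBSDTwoAt_two hR,
    congruentSilentEvenBSDTwoAt_two_of_congruentSilentEvenFiveBSDTwo hR⟩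

/-- **RUNG TWO `CongruentEvenBSDTwoAt 2` ⟹ C-P2-1, WITH NO FACT**: `𝒮⁻` pairs are `s = 1` cells by file 1
§2's linear algebra. The fact-free sibling of the landed
`Conjectures.congruentSilentEvenFiveBSDTwo_of_congruentEvenBSDTwoAt_two` (p365071; there `s = 1` comes
from `hMe` + Monsky Cor. 5.15 (2′) `h515`) — hence the prime. Asserts neither `Prop`.
[cite: Monsky1990MockHeegner, Cor. 5.15 (2′) and p. 67 Rem. (3)] -/
theorem congruentSilentEvenFiveBSDTwo_of_congruentEvenBSDTwoAt_two'
    (h : Conjectures.CongruentEvenBSDTwoAt 2) : Conjectures.CongruentSilentEvenFiveBSDTwo := by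
  intro p q hp hq hp5 hq4 hj
  have hne : p ≠ q := fun e => by omega
  have ht : ∀ i, (![p, q] i).Prime := fun i => by fin_cases i <;> assumption
  have hinj : Function.Injective ![p, q] := by
    intro i j hij
    fin_cases i <;> fin_cases j <;> simp_all [hne.symm]
  have hprod : ∏ i, ![p, q] i = p * q := by simp [Fin.prod_univ_two]
  have h6 : (2 * ∏ i, ![p, q] i) % 8 = 6 := by
    rw [hprod]
    have : (p * q) % 4 = 3 := by rw [Nat.mul_mod, show p % 4 = 1 by omega, hq4]
    omega
  have hres := h _ ht hinj h6 (monskySelmerRankEven_five_pair hp hq hp5 hq4)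
  rwa [hprod] at hres

/-- **C-P2-1 ⟹ RUNG TWO `CongruentEvenBSDTwoAt 2`, modulo {U⁺ `hU`, GZK, Monsky even `hMe`,
Rédei–Reichardt `hR`}** — by the landed law file's RULE `Conjectures.congruentEvenBSDTwoAt_of_silent`
(split a cell on the parity of `Σ₂′(n)`: even — the silent rung, `hR`; odd — DOOR B6 over census
vocabulary, {U⁺, GZK, `hMe`}). Asserts nothing; `hU` is a displayed hypothesis, not a fact of the tree.
[cite: TianYuanZhang2017, Thm. 1.2, Thm. 3.5] [cite: Monsky1990MockHeegner, p. 67 Rem. (3)]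
[cite: Miller2011LMS, Def. 1.1 (arXiv:1010.2431 p. 3)] -/
theorem congruentEvenBSDTwoAt_two_of_congruentSilentEvenFiveBSDTwo
    (hU : ∀ (n : ℕ), Squarefree n → (n % 8 = 5 ∨ n % 8 = 6 ∨ n % 8 = 7) →
      ∃ L : ℤ, IsScriptL n L ∧
        ((n % 8 = 5 ∨ n % 8 = 7) → (2 : ℤ) ∣ L →
          Even (genusSum₁ n fun d => genusClassNumber (GenusField d)) ∧
          Even (genusSum₂' n fun d => genusClassNumber (GenusField d))) ∧
        (n % 8 = 6 → (2 : ℤ) ∣ L → Even (genusSum₂' n fun d => genusClassNumber (GenusField d))))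
    (hGZK : rank_eq_analyticRank_of_analyticRank_le_one) (hMe : monsky_card_selmerGroup_two_even)
    (hR : redeiReichardt_fourTwoCard_classGroup) (h : Conjectures.CongruentSilentEvenFiveBSDTwo) :
    Conjectures.CongruentEvenBSDTwoAt 2 :=
  Conjectures.congruentEvenBSDTwoAt_of_silent hU hGZK hMe
    (congruentSilentEvenBSDTwoAt_two_of_congruentSilentEvenFiveBSDTwo hR h)

/-- **RUNG TWO ⟺ C-P2-1: `CongruentEvenBSDTwoAt 2 ⟺ CongruentSilentEvenFiveBSDTwo`, modulo {U⁺, GZK,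
`hMe`, `hR`}** — under the ruled quantifier `2 ≤ k` the typed even Monsky law's first rung is C-P2-1
and nothing more. Asserts neither side.
[cite: Monsky1990MockHeegner, Cor. 5.15 (2′) and p. 67 Rem. (3)] [cite: TianYuanZhang2017, Thm. 1.2, Thm. 3.5] -/
theorem congruentEvenBSDTwoAt_two_iff
    (hU : ∀ (n : ℕ), Squarefree n → (n % 8 = 5 ∨ n % 8 = 6 ∨ n % 8 = 7) →
      ∃ L : ℤ, IsScriptL n L ∧
        ((n % 8 = 5 ∨ n % 8 = 7) → (2 : ℤ) ∣ L →
          Even (genusSum₁ n fun d => genusClassNumber (GenusField d)) ∧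
          Even (genusSum₂' n fun d => genusClassNumber (GenusField d))) ∧
        (n % 8 = 6 → (2 : ℤ) ∣ L → Even (genusSum₂' n fun d => genusClassNumber (GenusField d))))
    (hGZK : rank_eq_analyticRank_of_analyticRank_le_one) (hMe : monsky_card_selmerGroup_two_even)
    (hR : redeiReichardt_fourTwoCard_classGroup) :
    Conjectures.CongruentEvenBSDTwoAt 2 ↔ Conjectures.CongruentSilentEvenFiveBSDTwo :=
  ⟨congruentSilentEvenFiveBSDTwo_of_congruentEvenBSDTwoAt_two',
    congruentEvenBSDTwoAt_two_of_congruentSilentEvenFiveBSDTwo hU hGZK hMe hR⟩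

end Rung

end Summit.BirchSwinnertonDyer.Rank1Residual.P2

end
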